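import Summits.ResolutionOfSingularities.ResolutionOfSingularities.Theorems.AbsoluteContactInsep
import Summits.ResolutionOfSingularities.ResolutionOfSingularities.Theorems.TameCutStage
import Summits.ResolutionOfSingularities.ResolutionOfSingularities.Theorems.LatencyCutCells
import HarnessLib

/-!
# TameContactInsep — decomp-res COMPANION node «TameContactInsep» (lens-6 g18), tree file 1/2: THE TAME CONTACT
THEOREM OVER EVERY FIELD

Content VERBATIM from the `CrossLens` section of the decomp-res lens-6 g18 COMPANION file
`HOME/decomp-res-lens-6/g18/TameContactInsep.lean`
(sha256 66dc0b21be89a4f7, 2212 l; its l. 1–2031 are the node «AbsoluteContactInsep» = the landed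
`Theorems/AbsoluteQFrame*` / `AbsoluteContactInsep`
chain and are not repeated; HOME = run/shared/lean/pub/decomp-res).  Critic: CRITIC-LEDGER row 141 (CLEARED
2026-08-30T20:24:52Z, DECIDED +1:
the tame contact theorem over every field; lens-4's tame–inseparable column collapses into 31571 BY KERNEL); split
per COMPANION-g18 §5.
Landed by decomp-res writer g7.  NO new aside (the tame–insep cells are theorems); row 137's single residual aside 28338
`LCNoWildContactFreeOffLocusTowers` stands.

This file (cone-free): section `CrossLens` l. 2046–2153 — `isAbsContactAt_stage_of_not_dvd`,
`isAbsContactAt_root_of_not_dvd`, `contactHugging_of_tame`,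
`dvd_of_forall_not_isAbsContactAt`, the column lemmas, the weight-`n` cells and iffs (namespace
`…Theorems.HugValuationCut` as written; imports the landed
`AbsoluteContactInsep` + `TameCutStage` + `LatencyCutCells`).  PROVED, 0 sorry.  The BY-NAME wiring on the
MaxContactCut items: `MaxContactCutTameContactInsep`.

[WRITER NOTE (decomp-res writer g7): section split only (`open …Theses` moved to the wiring file); PLUS, per
critic row 141 («when LatencyCut 2–5 land, add the
four g22-named one-liners … bookkeeping, whichever lands second» — LatencyCut landed first), the four one-line
instantiations of the column lemmas at the
landed `LatencyCutCells` names at the end of the section: `tameInsepContactFreeOffLocus_holds`,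
`tameInsepContactFreeNonPrincipal_holds`,
`contactFreeOffLocus_iff_wild`, `contactFreeNonPrincipal_iff_wild` (terms exactly as dictated by the critic /
COMPANION-g18 §5).]

## The lens's companion description (VERBATIM)

# TameContactInsep — decomp-res COMPANION of the lens-6 g18 node «AbsoluteContactInsep» (critic row 139, window (γ)):
# THE TAME CONTACT THEOREM OVER EVERY FIELD, and the collapse of lens-4's tame–inseparable column

HOME = run/shared/lean/pub/decomp-res.  This file = the g18 NODE `HOME/decomp-res-lens-6/g18/AbsoluteContactInsep.lean`
(sha256 3771488b…, CLEARED row 139) VERBATIM (its eight imports are the first two and the last six above; body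
unchanged, namespace `…Theorems.AbsoluteContactClasses`) followed by ONE NEW SECTION `CrossLens` in lens-4's namespace
`…Theorems.HugValuationCut`, written against the TREE files `Theorems/TameCutKernels` (lens-4 g21, the root contact
 theorem `contactHugging_of_isAbsContactAt_root`), `Theorems/TameCutStage` (lens-4 g22 file 1/5: `tower_isBase`,
`tower_idealOrder_pt_eq`) and `Theorems/MaxContactCutTameCut` (g21 BY-NAME wiring to the MaxContactCut items 31571
`NoContactHuggingTowers`, 31572 `NoWildHuggingTowers`, 32260 `NoSingularSurfaceHuggingTowers`, 30253 `NoForcedTowers`).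

## What the new section proves (all KERNEL, 0 sorry, standard axioms, NO port, NO hypothesis on the field)

* `isAbsContactAt_stage_of_not_dvd` — a forced tower over ANY field `k` of characteristic `p` with `IsBase` root and a
  weight-`n` datum, `p ∤ n`, has an ABSOLUTE CONTACT ELEMENT AT EVERY STAGE `j` (`Diff^{≤n−1}_ℤ(I_{j,x_j}) ⊄ 𝔪²`):
  lens-6 g18 `isAbsContactAt_of_not_dvd` at the stage base `toRoot T j ≫ g` (g22 `tower_isBase`,
  `tower_idealOrder_pt_eq`).  In particular NO TAME TOWER IS CONTACT-FREE: `dvd_of_forall_not_isAbsContactAt`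
  («a permanently absolutely contact-free forced tower is WILD», `p ∣ n`, any field) — this is g22's
  `ContactFreeTower n T → p ∣ n` by `Iff.rfl` once `LatencyCut` files 2–5 land, eliminating the second disjunct of
  g22's `dvd_or_not_sepResidueAt_of_contactFree`.
* `contactHugging_of_tame` — THE TAME CONTACT THEOREM WITHOUT THE SEPARABILITY BINDER: every forced tower of weight
  prime to `p` over any field is a CONTACT tower (g21 `contactHugging_of_tame_sep` needed `SepResidueAt g x₀`;
  g21/g22 tagged the inseparable-root tame cells «ATTACKABLE for F-finite k · IDEA-NEEDED for [k:k^p] = ∞» — decided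
  here for every `k`).
* Columns: `noTowerTameInsep_of_contact` (the tame–INSEPARABLE slab of EVERY class terminates as soon as 31571 does at
  the weight), `noTowerTameInsep_of_not_contact` (a class disjoint from contact has EMPTY tame–insep slab),
  `noTowerTame_of_contact` (both tame slabs), `noTowerTameInsep_contactFree` (the tame–insep CONTACT-FREE bed of every
  class is EMPTY — g22's `TameInsepContactFreeOffLocusTowersTerminate n` /
  `TameInsepContactFreeNonPrincipalInLocusTowersTerminate n` DECIDED TRUE by `Iff.rfl` on landing),
  `noTower_contactFree_iff_wild` (the contact-free column of every class IS its wild contact-free column, EXACT,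
  hypothesis-free — g22's `ContactFreeOffLocusTowersTerminate n ⟺ WildContactFreeOffLocusTowersTerminate n` on landing:
  lens-4's located residual re-located to the WILD CONTACT-FREE CELL ALONE).
* Cells at weight `n` (tree g21 names): `tameInsepOffLocus_of_contact`, `tameInsepNonPrincipal_of_contact` (⊆ 31571 BY
  KERNEL, every field), `tameInsepWildHugging_empty` (`TameInsepWildHuggingTowersTerminate n` DECIDED TRUE, port-free);
  EXACT re-locations `offLocus_iff_wild`, `nonPrincipal_iff_wild` (given 31571 at the weight: `(O) ⟺ (O, wild)`,
  `(L,¬P) ⟺ (L,¬P, wild)` — the tame–insep conjuncts of g21's `offLocus_iff_g21` / `nonPrincipal_iff_g21` are gone) and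
  `wildHugging_iff_wildWild` (31572 at the weight `⟺ (31572, wild)`, NO hypothesis: «KANGAROOS ARE WILD» — an infinite
  tower hugging a germ but no regular hypersurface germ has `p ∣ n`, full stop).
* All weights BY NAME (Theses cone, as `MaxContactCutTameCut`): `noTameInsepOffLocusTowers_of_item`,
  `noTameInsepNonPrincipalInLocusTowers_of_item` (from 31571), `noTameInsepWildHuggingTowers_holds` (TRUE),
  `noWildHuggingTowers_iff_wildWild : MaxContactCut.NoWildHuggingTowers ⟺ NoWildWildHuggingTowers` (31572 EXACT, no
  hypothesis), `noOffLocusShadowTowers_iff_wild`, `noNonPrincipalInLocusTowers_iff_wild` (given 31571),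
  `noSingularSurfaceHuggingTowers_iff_gamma` (THE HOST 32260 with g21's hypothesis list EXACTLY:
  `⟺ NoWildOffLocusTowers ∧ NoWildNonPrincipalInLocusTowers ∧ NoPurePrincipalTowers ∧
  NoIncommensurableWildDriftingImperfectTowers` — g21's two tame–insep conjuncts discharged), `noForcedTowers_iff_gamma`
  (the ROOT 30253 `⟺ 31571 ∧` the same four cells).

INHABITANT of the decided slab (tame weight, INSEPARABLE root residue field; desk, see the companion md): every census
tame chain over `𝔽_p` (HOME/census/iz/T-IZ1-all.json, 404 chains with `p ∤ n`, e.g. `2:A3line:y2+x4u:FOFF1:1`,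
`5:Q-line:y5+x6u4:FOFF1:54`) base-changed to `K = 𝔽_p(a)(a^{1/p})` and viewed over `k = 𝔽_p(a)`: a forced tower over `k`
(blow-ups and orders commute with the flat base change; the centres stay reduced `K`-points), `IsBase`, same weight,
root residue field `K ⊋ k` purely inseparable; and lens-6 g17 §4 (`p = 5`, `k = 𝔽₅(a)`, marking 3).

(Sources: Giraud1975; EGAIV4 Thm. 16.11.2; KimuraNiitsuma1980 Thm. 3.4; EncinasVillamayor2000 Thm. 4.9;
CossartJannsenSaito2020; CossartPiltant2019; Moh1987.)

(Sources: Giraud1975; EGA IV 16.11.2; KimuraNiitsuma1980 Thm 3.4; EncinasVillamayor2000 Thm 4.9; CossartPiltant2008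
Prop 4.2; CossartJannsenSaito2020; CossartPiltant2019.)
-/

noncomputable section

open CategoryTheory AlgebraicGeometry IsLocalRing
open Literature.AlgebraicGeometry.Resolution
open Summit.ResolutionOfSingularities.ResolutionOfSingularities.Theorems
open WeakOrderReduction ForcedTowerClasses DivergentTowerClasses MonomialTowerClasses
open HugDimensionClasses HugDimensionKernels SurfaceShadowClasses SurfaceShadowKernels
open NearPointCut (SingularClass)
open AbsoluteContactClasses (IsAbsContactAt SepResidueAt isAbsContactAt_of_not_dvd)

namespace Summit.ResolutionOfSingularities.ResolutionOfSingularities.Theorems.HugValuationCut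

section CrossLens

variable {k : Type} [Field k]

/-- **KERNEL (γ1): ABSOLUTE CONTACT AT EVERY STAGE of a tame forced tower over ANY field** — `p ∤ n` ⇒
`Diff^{≤ n−1}_ℤ(I_{j,x_j}) ⊄ 𝔪_{x_j}²` for every `j` (lens-6 g18 `isAbsContactAt_of_not_dvd` at the stage base
`toRoot T j ≫ g`). (Sources: Giraud1975; EGAIV4 Thm. 16.11.2; KimuraNiitsuma1980 Thm. 3.4.) -/
theorem isAbsContactAt_stage_of_not_dvd {p : ℕ} (hp : p.Prime) {n : ℕ} (hpn : ¬ p ∣ n) [CharP k p]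
    (T : ForcedTower) (g : T.St 0 ⟶ Spec (.of k)) (hB : IsBase (T.St 0) g) (hD : IsDatum n (T.D 0)) (j : ℕ) :
    IsAbsContactAt (T.D j).ideal n (T.pt j) :=
  isAbsContactAt_of_not_dvd hp (Nat.pos_of_ne_zero fun h : n = 0 => hpn (h ▸ dvd_zero p)) hpn (T.St j) (toRoot T j ≫ g)
    (tower_isBase T g hB j) (T.D j).ideal (T.pt j) (T.isClosed_pt j) (tower_idealOrder_pt_eq T g hB hD j)

/-- **KERNEL (γ1, root form).** [folklore] -/
theorem isAbsContactAt_root_of_not_dvd {p : ℕ} (hp : p.Prime) {n : ℕ} (hpn : ¬ p ∣ n) [CharP k p]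
    (T : ForcedTower) (g : T.St 0 ⟶ Spec (.of k)) (hB : IsBase (T.St 0) g) (hD : IsDatum n (T.D 0)) :
    IsAbsContactAt (T.D 0).ideal n (T.pt 0) :=
  isAbsContactAt_stage_of_not_dvd hp hpn T g hB hD 0

/-- **THE TAME CONTACT THEOREM OVER EVERY FIELD (γ2 · KERNEL, hypothesis-free, no port): a forced tower of weight
prime to `p` hugs a regular hypersurface germ for ever** — no separability of the root residue field needed
(g21 `contactHugging_of_tame_sep` minus its binder). (Sources: Giraud1975; EncinasVillamayor2000 Thm. 4.9.) -/
theorem contactHugging_of_tame {p : ℕ} (hp : p.Prime) {n : ℕ} (hpn : ¬ p ∣ n) [CharP k p]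
    (T : ForcedTower) (g : T.St 0 ⟶ Spec (.of k)) (hB : IsBase (T.St 0) g) (hD : IsDatum n (T.D 0)) :
    ContactHugging T := by
  obtain ⟨N, rfl⟩ : ∃ N, n = N + 1 := ⟨n - 1, by have : n ≠ 0 := fun h => hpn (h ▸ dvd_zero p); omega⟩
  exact contactHugging_of_isAbsContactAt_root T g hB hD (isAbsContactAt_root_of_not_dvd hp hpn T g hB hD)

/-- **KERNEL (γ3): A PERMANENTLY ABSOLUTELY CONTACT-FREE FORCED TOWER IS WILD** (`p ∣ n`, any field) — g22's
`ContactFreeTower n T → p ∣ n` verbatim once `LatencyCut` lands. [folklore] -/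
theorem dvd_of_forall_not_isAbsContactAt {p : ℕ} (hp : p.Prime) {n : ℕ} [CharP k p]
    (T : ForcedTower) (g : T.St 0 ⟶ Spec (.of k)) (hB : IsBase (T.St 0) g) (hD : IsDatum n (T.D 0))
    (h : ∀ j, ¬ IsAbsContactAt (T.D j).ideal n (T.pt j)) : p ∣ n := by
  by_contra hpn
  exact h 0 (isAbsContactAt_root_of_not_dvd hp hpn T g hB hD)

/-! ### columns -/

/-- **KERNEL: THE TAME–INSEPARABLE SLAB OF EVERY CLASS IS A CONTACT SLAB** — it terminates as soon as 31571 does at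
the weight (no port, any field). [folklore] -/
theorem noTowerTameInsep_of_contact {n : ℕ} {P : ForcedTower → Prop} (h : ContactHuggingTowersTerminate n) :
    NoTowerTameInsep n P :=
  fun p hp hpn k _ _ T g hB hD hE _ _ => h p hp k T g hB hD hE (contactHugging_of_tame hp hpn T g hB hD)

/-- **KERNEL: a class DISJOINT from contact has EMPTY tame–inseparable slab** (hypothesis-free). [folklore] -/
theorem noTowerTameInsep_of_not_contact {n : ℕ} {P : ForcedTower → Prop} (hP : ∀ T, P T → ¬ ContactHugging T) :
    NoTowerTameInsep n P :=
  fun _ hp hpn _ _ _ T g hB hD _ _ hPT => hP T hPT (contactHugging_of_tame hp hpn T g hB hD)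

/-- **KERNEL: BOTH TAME SLABS of every class are contact slabs.** [folklore] -/
theorem noTowerTame_of_contact {n : ℕ} {P : ForcedTower → Prop} (h : ContactHuggingTowersTerminate n) :
    NoTowerTameSep n P ∧ NoTowerTameInsep n P :=
  ⟨noTowerTameSep_of_contact h, noTowerTameInsep_of_contact h⟩

/-- **KERNEL (hypothesis-free): THE TAME–INSEPARABLE CONTACT-FREE BED OF EVERY CLASS IS EMPTY** — g22's
`TameInsepContactFree…TowersTerminate n` for both (O) and (L,¬P), by `Iff.rfl` on landing. [folklore] -/
theorem noTowerTameInsep_contactFree {n : ℕ} (P : ForcedTower → Prop) :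
    NoTowerTameInsep n fun T => P T ∧ ∀ j, ¬ IsAbsContactAt (T.D j).ideal n (T.pt j) :=
  fun _ hp hpn _ _ _ T g hB hD _ _ hPT => hPT.2 0 (isAbsContactAt_root_of_not_dvd hp hpn T g hB hD)

/-- **KERNEL (hypothesis-free): THE TAME–SEPARABLE CONTACT-FREE BED is empty too** (already g22; here without the
separability case distinction). [folklore] -/
theorem noTowerTameSep_contactFree' {n : ℕ} (P : ForcedTower → Prop) :
    NoTowerTameSep n fun T => P T ∧ ∀ j, ¬ IsAbsContactAt (T.D j).ideal n (T.pt j) :=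
  fun _ hp hpn _ _ _ T g hB hD _ _ hPT => hPT.2 0 (isAbsContactAt_root_of_not_dvd hp hpn T g hB hD)

/-- **EXACT, hypothesis-free: THE CONTACT-FREE COLUMN OF EVERY CLASS IS ITS WILD CONTACT-FREE COLUMN** — g22's located
residual `ContactFreeOffLocusTowersTerminate n ⟺ WildContactFreeOffLocusTowersTerminate n` (and the (L,¬P) analogue)
on landing: lens-4's residual lives in the WILD contact-free cell ALONE. [folklore] -/
theorem noTower_contactFree_iff_wild {n : ℕ} (P : ForcedTower → Prop) :
    (NoTower n fun T => P T ∧ ∀ j, ¬ IsAbsContactAt (T.D j).ideal n (T.pt j)) ↔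
      NoTowerWild n fun T => P T ∧ ∀ j, ¬ IsAbsContactAt (T.D j).ideal n (T.pt j) := by
  refine ⟨noTowerWild_of_noTower, fun hW p hp k _ _ T g hB hD hE hPT => ?_⟩
  by_cases hpn : p ∣ n
  · exact hW p hp hpn k T g hB hD hE hPT
  · exact hPT.2 0 (isAbsContactAt_root_of_not_dvd hp hpn T g hB hD)

/-! ### cells at weight `n` (tree g21 names) -/

/-- **(O, tame, inseparable root) ⊆ 31571 BY KERNEL — every field** (g21: «IDEA-NEEDED for `[k:k^p] = ∞`»).
[folklore] -/
theorem tameInsepOffLocus_of_contact {n : ℕ} (h : ContactHuggingTowersTerminate n) :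
    TameInsepOffLocusTowersTerminate n :=
  noTowerTameInsep_of_contact h

/-- **(L,¬P, tame, inseparable root) ⊆ 31571 BY KERNEL — every field.** [folklore] -/
theorem tameInsepNonPrincipal_of_contact {n : ℕ} (h : ContactHuggingTowersTerminate n) :
    TameInsepNonPrincipalInLocusTowersTerminate n :=
  noTowerTameInsep_of_contact h

/-- **(31572, tame, inseparable root) IS EMPTY — DECIDED TRUE, port-free, hypothesis-free.** [folklore] -/
theorem tameInsepWildHugging_empty {n : ℕ} : TameInsepWildHuggingTowersTerminate n :=
  noTowerTameInsep_of_not_contact fun _ h => h.2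

/-- **EXACT RE-LOCATION OF (O) GIVEN 31571 at the weight: `(O) ⟺ (O, wild)`** (g21's tame–insep conjunct gone).
[folklore] -/
theorem offLocus_iff_wild {n : ℕ} (h : ContactHuggingTowersTerminate n) :
    OffLocusShadowTowersTerminate n ↔ WildOffLocusTowersTerminate n :=
  (offLocus_iff_g21 h).trans ⟨fun h' => h'.1, fun h' => ⟨h', tameInsepOffLocus_of_contact h⟩⟩

/-- **EXACT RE-LOCATION OF (L,¬P) GIVEN 31571 at the weight: `(L,¬P) ⟺ (L,¬P, wild)`.** [folklore] -/
theorem nonPrincipal_iff_wild {n : ℕ} (h : ContactHuggingTowersTerminate n) :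
    NonPrincipalInLocusTowersTerminate n ↔ WildNonPrincipalInLocusTowersTerminate n :=
  (nonPrincipal_iff_g21 h).trans ⟨fun h' => h'.1, fun h' => ⟨h', tameInsepNonPrincipal_of_contact h⟩⟩

/-- **EXACT, NO hypothesis: 31572 at weight `n` IS its wild cell — «kangaroos are wild»: an infinite tower hugging a
germ but no regular hypersurface germ has `p ∣ n`.** [folklore] -/
theorem wildHugging_iff_wildWild {n : ℕ} : WildHuggingTowersTerminate n ↔ WildWildHuggingTowersTerminate n :=
  wildHugging_iff_g21.trans ⟨fun h => h.1, fun h => ⟨h, tameInsepWildHugging_empty⟩⟩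

/-! ### g22 cells BY NAME (critic row 141 bookkeeping, «whichever lands second»: the landed `LatencyCutCells` names) -/

/-- g22's (O, tame–insep, contact-free) cell is EMPTY, hypothesis-free. [folklore] -/
theorem tameInsepContactFreeOffLocus_holds {n : ℕ} : TameInsepContactFreeOffLocusTowersTerminate n :=
  noTowerTameInsep_contactFree _

/-- g22's (L,¬P, tame–insep, contact-free) cell is EMPTY, hypothesis-free. [folklore] -/
theorem tameInsepContactFreeNonPrincipal_holds {n : ℕ} : TameInsepContactFreeNonPrincipalInLocusTowersTerminate n :=
  noTowerTameInsep_contactFree _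

/-- g22's located residual (O, contact-free) IS its wild cell, hypothesis-free. [folklore] -/
theorem contactFreeOffLocus_iff_wild {n : ℕ} :
    ContactFreeOffLocusTowersTerminate n ↔ WildContactFreeOffLocusTowersTerminate n :=
  noTower_contactFree_iff_wild _

/-- g22's located residual (L,¬P, contact-free) IS its wild cell, hypothesis-free. [folklore] -/
theorem contactFreeNonPrincipal_iff_wild {n : ℕ} :
    ContactFreeNonPrincipalInLocusTowersTerminate n ↔ WildContactFreeNonPrincipalInLocusTowersTerminate n :=
  noTower_contactFree_iff_wild _

end CrossLens

end Summit.ResolutionOfSingularities.ResolutionOfSingularities.Theorems.HugValuationCut
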